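import Summits.MatrixMultiplication.OmegaCensus.SmallFormats.BoxCertificatePattern
import HarnessLib

/-!
# ω-census family (a): `BoxCert` certificates with ORBITAL branching (symmetry nodes), pattern leaves and multiplier leaves

Cell `pub-omega` (unit `pub-omega-tensor-g11`), topic `Summits/MatrixMultiplication/OmegaCensus` (sub-folder `SmallFormats`).
Framing (verbatim): lottery ticket; floor = certified bounds/negative ranges. HONEST FRAMING: generic bookkeeping, no matrix
multiplication content. `CertO` = the branch-and-bound certificate format of `BoxCertificate` / `BoxCertificatePattern` (multiplier
leaves, infeasible-row leaves, single-variable pattern leaves, branches) plus ONE new node kind, the ORBIT node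
`orbit c ws up dn`: at a box `B`, with `c` a variable and `ws` a list of pairs `(d, w)` — `w` a word in a fixed symmetry action
`apply : List ℕ → ℕ → ℕ` — the checker verifies that every `σ_w = apply w` maps the box `B` to itself (`lo/hi` agree at `j` and
`σ_w j` for all `j < N`), sends `c ↦ d`, and preserves the pattern table; then it checks `up` on `B ∩ {x_c ≥ lo_c + 1}` and `dn` on
`B ∩ {x_d = lo_c for d = c and all listed d}`. Soundness (`CertO.sum_lt_of_check`): if feasibility, the total and the box membership are
invariant under every `σ_w` (hypotheses `hfeas`, `htot`, `happly`), then a passing certificate bounds every feasible pattern-OK point of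
the box — because a point with some `x_d ≥ lo + 1` is transported by `σ_w` to a point of the SAME box with `x_c ≥ lo + 1`. This is
orbital branching (Ostrowski–Linderoth–Rossi–Smriglio) made kernel-checkable; symmetric siblings cost no leaves. PURPOSE: step (d) of
the successor blueprint `pub-omega-tensor-g11/METHOD-PARITY-g11.md` §3 (slack-4 `𝔽₅` X-cap replay: all-odd pattern closes with 6
multiplier leaves, `|S_β| = 4` patterns with ≈ 170, measured by tensor-g11 `bb7.py`).
-/

namespace Summit.MatrixMultiplication.OmegaCensus.SmallFormats.BoxCert

open Finset

/-- Symmetry side information: a word action on variable indices and the inverse lookup of the pattern table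
(`cellOf (Q.var i) = i`; used to check that a symmetry preserves the pattern). -/
structure OrbitData where
  /-- `apply w` = the permutation of the word `w` -/
  apply : List ℕ → ℕ → ℕ
  /-- listed-variable index ↦ position in the pattern table -/
  cellOf : ℕ → ℕ

/-- Branch-and-bound certificates with orbit nodes. -/
inductive CertO where
  /-- pruned by multipliers `y` (numerators over the common denominator `D`) -/
  | leaf (y : ℕ → ℕ) : CertO
  /-- pruned because row `r` is violated by every point of the box -/
  | infeasible (r : ℕ) : CertO
  /-- pruned because listed variable `i` of the pattern table is fixed by the box to a value of the wrong parity -/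
  | pat (i : ℕ) : CertO
  /-- split on `x j ≥ v + 1` (first child) versus `x j ≤ v` (second child) -/
  | branch (j v : ℕ) (up down : CertO) : CertO
  /-- orbital split at variable `c` with symmetric variables `ws = [(d, word), …]`:
  `x c ≥ lo + 1` (first child) versus `x d = lo` for `d = c` and every listed `d` (second child) -/
  | orbit (c : ℕ) (ws : List (ℕ × List ℕ)) (up down : CertO) : CertO

variable (S : System) (Q : PatternData) (A : OrbitData)

/-- `σ` preserves the pattern table: every listed variable goes to a listed variable with the same bit. -/
def PatternData.permOK (cellOf : ℕ → ℕ) (σ : ℕ → ℕ) : Bool :=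
  (List.range Q.n).all fun i =>
    decide (cellOf (σ (Q.var i)) < Q.n) && decide (Q.var (cellOf (σ (Q.var i))) = σ (Q.var i)) &&
      decide (Q.bit (cellOf (σ (Q.var i))) = Q.bit i)

/-- `σ` maps the box of `path` to itself (checked on the variables `< N`). -/
def boxInvariant (s : ℕ) (path : List (ℕ × ℕ × ℕ)) (σ : ℕ → ℕ) : Bool :=
  (List.range S.N).all fun j => decide (loOf path (σ j) = loOf path j) && decide (hiOf s path (σ j) = hiOf s path j)

/-- The path of the second child of an orbit node: `c` and every listed `d` fixed at `lo_c`. -/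
def orbitDownPath (c lo : ℕ) (ws : List (ℕ × List ℕ)) (path : List (ℕ × ℕ × ℕ)) : List (ℕ × ℕ × ℕ) :=
  (c, lo, lo) :: ((ws.map fun dw => (dw.1, lo, lo)) ++ path)

/-- The orbit-node test (everything except the recursive checks). -/
def orbitOK (s c : ℕ) (ws : List (ℕ × List ℕ)) (path : List (ℕ × ℕ × ℕ)) : Bool :=
  decide (loOf path c < hiOf s path c) &&
    ws.all fun dw =>
      decide (A.apply dw.2 c = dw.1) && boxInvariant S s path (A.apply dw.2) && Q.permOK A.cellOf (A.apply dw.2)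

/-- The certificate checker (pure `ℕ/ℤ` arithmetic, meant for `decide +kernel`). -/
def CertO.check (D T s : ℕ) : CertO → List (ℕ × ℕ × ℕ) → Bool
  | .leaf y, path => S.leafOK D T s y path
  | .infeasible r, path => decide (r < S.M) && S.rowInfeasible s r path
  | .pat i, path => Q.leafOK s i path
  | .branch j v up dn, path =>
      decide (loOf path j ≤ v) && decide (v < hiOf s path j) &&
        up.check D T s ((j, v + 1, hiOf s path j) :: path) && dn.check D T s ((j, loOf path j, v) :: path)
  | .orbit c ws up dn, path =>
      orbitOK S Q A s c ws path &&
        up.check D T s ((c, loOf path c + 1, hiOf s path c) :: path) &&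
          dn.check D T s (orbitDownPath c (loOf path c) ws path)

/-! ## Soundness -/

section soundness

variable {S Q A}
variable (hfeas : ∀ (w : List ℕ) (x : ℕ → ℕ), S.Feasible x → S.Feasible fun j => x (A.apply w j))
  (htot : ∀ (w : List ℕ) (x : ℕ → ℕ), ∑ j ∈ range S.N, x (A.apply w j) = ∑ j ∈ range S.N, x j)
  (happly : ∀ (w : List ℕ) (j : ℕ), S.N ≤ j → A.apply w j = j)

/-- A pattern-preserving permutation transports `PatternData.OK`. -/
theorem PatternData.OK_comp {σ : ℕ → ℕ} (h : Q.permOK A.cellOf σ = true) {x : ℕ → ℕ} (hx : Q.OK x) :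
    Q.OK fun j => x (σ j) := by
  intro i hi
  have h' := List.all_eq_true.1 h i (List.mem_range.2 hi)
  simp only [Bool.and_eq_true, decide_eq_true_eq] at h'
  obtain ⟨⟨hlt, hvar⟩, hbit⟩ := h'
  have := hx _ hlt
  rw [hvar, hbit] at this
  exact this

include happly in
/-- A box-preserving permutation transports box membership. -/
theorem inBox_comp {s : ℕ} {path : List (ℕ × ℕ × ℕ)} {σ : List ℕ} (h : boxInvariant S s path (A.apply σ) = true)
    {x : ℕ → ℕ} (hx : InBox s path x) : InBox s path fun j => x (A.apply σ j) := by
  intro j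
  by_cases hj : j < S.N
  · have h' := List.all_eq_true.1 h j (List.mem_range.2 hj)
    simp only [Bool.and_eq_true, decide_eq_true_eq] at h'
    obtain ⟨hlo, hhi⟩ := h'
    exact ⟨hlo ▸ (hx _).1, hhi ▸ (hx _).2⟩
  · show loOf path j ≤ x (A.apply σ j) ∧ x (A.apply σ j) ≤ hiOf s path j
    rw [happly σ j (not_lt.1 hj)]; exact hx j

/-- Membership in the second child's box: all orbit variables are fixed at `lo`. -/
theorem inBox_orbitDown {s c lo : ℕ} {ws : List (ℕ × List ℕ)} {path : List (ℕ × ℕ × ℕ)} {x : ℕ → ℕ} (hx : InBox s path x)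
    (hc : x c = lo) (hws : ∀ dw ∈ ws, x dw.1 = lo) : InBox s (orbitDownPath c lo ws path) x := by
  unfold orbitDownPath
  -- peel the fixed entries one by one
  have key : ∀ (l : List (ℕ × List ℕ)), (∀ dw ∈ l, x dw.1 = lo) →
      InBox s ((l.map fun dw => (dw.1, lo, lo)) ++ path) x := by
    intro l hl
    induction l with
    | nil => simpa using hx
    | cons dw l ih =>
      have hdw : x dw.1 = lo := hl dw (by simp)
      have ih' := ih (fun dw' h' => hl dw' (by simp [h']))
      intro j
      simp only [List.map_cons, List.cons_append]
      by_cases hj : j = dw.1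
      · subst hj; rw [loOf_cons_self, hiOf_cons_self]; exact ⟨hdw.ge, hdw.le⟩
      · rw [loOf_cons_ne hj, hiOf_cons_ne hj]; exact ih' j
  intro j
  by_cases hj : j = c
  · subst hj; rw [loOf_cons_self, hiOf_cons_self]; exact ⟨hc.ge, hc.le⟩
  · rw [loOf_cons_ne hj, hiOf_cons_ne hj]; exact key ws hws j

include hfeas htot happly in
/-- **Soundness of the checker** (relative to the pattern hypothesis and the symmetry hypotheses). -/
theorem CertO.sum_lt_of_check (hwf : S.ColWF) {D T s : ℕ} :
    ∀ (cert : CertO) (path : List (ℕ × ℕ × ℕ)), cert.check S Q A D T s path = true →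
      ∀ x : ℕ → ℕ, InBox s path x → S.Feasible x → Q.OK x → ∑ j ∈ range S.N, x j < T
  | .leaf y, path, h, x, hbox, hf, _ => S.sum_lt_of_leafOK hwf (by simpa [CertO.check] using h) hbox hf
  | .infeasible r, path, h, x, hbox, hf, _ => by
      simp only [CertO.check, Bool.and_eq_true, decide_eq_true_eq] at h
      exact (S.false_of_rowInfeasible h.1 h.2 hbox hf).elim
  | .pat i, path, h, x, hbox, _, hpat => by
      simp only [CertO.check] at h
      exact (Q.false_of_leafOK h hbox hpat).elim
  | .branch j v up dn, path, h, x, hbox, hf, hpat => by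
      simp only [CertO.check, Bool.and_eq_true, decide_eq_true_eq] at h
      obtain ⟨⟨⟨_, _⟩, hup⟩, hdn⟩ := h
      rcases Nat.lt_or_ge v (x j) with hv | hv
      · exact CertO.sum_lt_of_check hwf up _ hup x (inBox_up hbox hv) hf hpat
      · exact CertO.sum_lt_of_check hwf dn _ hdn x (inBox_down hbox hv) hf hpat
  | .orbit c ws up dn, path, h, x, hbox, hf, hpat => by
      simp only [CertO.check, Bool.and_eq_true] at h
      obtain ⟨⟨hok, hup⟩, hdn⟩ := h
      simp only [orbitOK, Bool.and_eq_true, decide_eq_true_eq] at hok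
      obtain ⟨hlohi, hall⟩ := hok
      -- Case 1: the representative itself is raised.
      by_cases hc : loOf path c + 1 ≤ x c
      · exact CertO.sum_lt_of_check hwf up _ hup x (inBox_up hbox hc) hf hpat
      -- Case 2: some listed symmetric variable is raised: transport.
      by_cases hex : ∃ dw ∈ ws, loOf path c + 1 ≤ x dw.1
      · obtain ⟨dw, hmem, hd⟩ := hex
        have hw := List.all_eq_true.1 hall dw hmem
        simp only [Bool.and_eq_true, decide_eq_true_eq] at hw
        obtain ⟨⟨hcd, hinv⟩, hperm⟩ := hw
        set x' : ℕ → ℕ := fun j => x (A.apply dw.2 j) with hx'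
        have hbox' : InBox s path x' := inBox_comp happly hinv hbox
        have hf' : S.Feasible x' := hfeas dw.2 x hf
        have hpat' : Q.OK x' := PatternData.OK_comp hperm hpat
        have hc' : loOf path c + 1 ≤ x' c := by simp only [hx', hcd]; exact hd
        have hlt := CertO.sum_lt_of_check hwf up _ hup x' (inBox_up hbox' hc') hf' hpat'
        rwa [hx', htot dw.2 x] at hlt
      -- Case 3: the whole orbit sits at `lo`.
      · have hcx : x c = loOf path c := by have := (hbox c).1; omega
        have hws : ∀ dw ∈ ws, x dw.1 = loOf path c := by
          intro dw hmem
          have hw := List.all_eq_true.1 hall dw hmem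
          simp only [Bool.and_eq_true, decide_eq_true_eq] at hw
          obtain ⟨⟨hcd, hinv⟩, _⟩ := hw
          have hlt : ¬ loOf path c + 1 ≤ x dw.1 := fun h' => hex ⟨dw, hmem, h'⟩
          -- the box is invariant, so `lo` at `d = σ c` equals `lo` at `c`
          have hlo : loOf path dw.1 = loOf path c := by
            by_cases hcN : c < S.N
            · have h' := List.all_eq_true.1 hinv c (List.mem_range.2 hcN)
              simp only [Bool.and_eq_true, decide_eq_true_eq] at h'
              rw [← hcd]; exact h'.1
            · rw [← hcd, happly dw.2 c (not_lt.1 hcN)]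
          have := (hbox dw.1).1
          rw [hlo] at this
          omega
        exact CertO.sum_lt_of_check hwf dn _ hdn x (inBox_orbitDown hbox hcx hws) hf hpat

end soundness

/-- **Root form**: a passing certificate at the root box bounds every feasible pattern-OK `x ≤ s` by `∑_{j<N} x j < T`. -/
theorem CertO.sum_lt_of_check_root {S : System} {Q : PatternData} {A : OrbitData}
    (hfeas : ∀ (w : List ℕ) (x : ℕ → ℕ), S.Feasible x → S.Feasible fun j => x (A.apply w j))
    (htot : ∀ (w : List ℕ) (x : ℕ → ℕ), ∑ j ∈ range S.N, x (A.apply w j) = ∑ j ∈ range S.N, x j)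
    (happly : ∀ (w : List ℕ) (j : ℕ), S.N ≤ j → A.apply w j = j)
    (hwf : S.ColWF) {D T s : ℕ} (c : CertO) (h : c.check S Q A D T s [] = true)
    (x : ℕ → ℕ) (hx : ∀ j, x j ≤ s) (hf : S.Feasible x) (hpat : Q.OK x) : ∑ j ∈ range S.N, x j < T :=
  CertO.sum_lt_of_check hfeas htot happly hwf c [] h x (inBox_nil hx) hf hpat

/-- Assembly step for certificate skeletons: a branch node passes if its side conditions hold and both children pass. -/
theorem CertO.check_branch {D T s j v : ℕ} {up dn : CertO} {path : List (ℕ × ℕ × ℕ)}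
    (h1 : loOf path j ≤ v) (h2 : v < hiOf s path j)
    (hu : up.check S Q A D T s ((j, v + 1, hiOf s path j) :: path) = true)
    (hd : dn.check S Q A D T s ((j, loOf path j, v) :: path) = true) :
    (CertO.branch j v up dn).check S Q A D T s path = true := by
  simp [CertO.check, h1, h2, hu, hd]

/-! ## A toy instance: `x₀ + x₁ ≤ 1` on `[0,1]²` with the swap symmetry `(0 1)`; orbit node at `c = 0` with `ws = [(1, [0])]`:
first child `x₀ = 1` (then `x₁ = 1` violates the row and `x₁ = 0` is closed by the multiplier `y₀ = 1`), second child `x₀ = x₁ = 0`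
closed by `y = 0`. Claim `∑ < 2`. -/

/-- Toy symmetry: every nonempty word swaps `0` and `1`; no pattern table. -/
def toyA : OrbitData := ⟨fun w j => if w.length % 2 = 1 then (if j = 0 then 1 else if j = 1 then 0 else j) else j, fun j => j⟩
/-- Toy pattern table (empty). -/
def toyQ0 : PatternData := ⟨0, fun i => i, fun _ => 0⟩

/-- The toy orbit certificate passes. -/
example : (CertO.orbit 0 [(1, [0])] (CertO.branch 1 0 (CertO.infeasible 0) (CertO.leaf fun _ => 1)) (CertO.leaf fun _ => 0)).check
    toy toyQ0 toyA 1 2 1 [] = true := by decide +kernel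

end Summit.MatrixMultiplication.OmegaCensus.SmallFormats.BoxCert
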